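import Mathlib
import Literature.Probability.LatticeModels.ThermodynamicLimit
import Literature.Probability.LatticeModels.SharpnessProofs
import Summits.CriticalPhenomena.Ising3DConformalLimit.Theorems.PrecisionLaplacianDirectCorrelationStableTailLevyContinuityTransferAux
import Summits.CriticalPhenomena.Ising3DConformalLimit.Theorems.PrecisionLaplacianDirectCorrelationStableTailLevyContinuityTransferAux2
import Summits.CriticalPhenomena.Ising3DConformalLimit.Theorems.PrecisionLaplacianDirectCorrelationStableTailLevyContinuityTransferAux3
import Summits.CriticalPhenomena.Ising3DConformalLimit.Theorems.PrecisionLaplacianDirectCorrelationStableTailLevyContinuityTransferAux4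
import HarnessLib

/-!
# Stub `stub_levyContinuityTransfer` of line `diffusive-branch-is-nonsaturation`
(crux `Summit.CriticalPhenomena.Ising3DConformalLimit.Theses.PrecisionLaplacian.DirectCorrelationStableTail`,
item stmt-CriticalPhenomena-4799)

**Lévy continuity transfer: symbol convergence + tightness ⇒ vague convergence of the rescaled
lattice measures to the isotropic `α`-stable Lévy measure.**

Statement (`stub_levyContinuityTransfer`).  Let `m ∈ ℓ¹(ℤ³)` be even and nonnegative off the
origin, `0 < α < 2`, `c' > 0`.  Assume tightness at infinity (`R^α ∑_{y ∈ T} m(y) ≤ C` for finite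
`T ⊆ {‖y‖_∞ ≥ R}`, `R ≥ R₁`), tightness at the origin (`∑_{‖y‖_∞ ≤ R} m(y)|y|₂² ≤ C' R^{2-α}`,
`R ≥ 1`) and convergence of the symbols
`ψ_R(k) = R^α ∑_y m(y)(1 - cos(k·y/R)) → c'|k|₂^α` for every `k ∈ ℝ³`.  Then there is `Φ₀ > 0`
such that for every continuous compactly supported `f` on `ℝ³` vanishing near the origin,
`R^α ∑ₓ m(x) f(x/R) → ∫ f(y) Φ₀ |y|₂^{-3-α} dy`.

Proof (P. Lévy's continuity theorem for the Gaussian-weighted measures).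
1. *Measures.*  With the weight `g(u) = 1 - e^{-|u|₂²/2} = ∫ γ(η)(1 - cos(η·u)) dη` (`γ` the standard
   Gaussian density; `levyCT_weight_eq_gauss_average`), let `μ_R = ∑ₓ R^α m(x) g(x/R) δ_{x/R}`
   (finite positive measures on `ℝ³`; the origin carries no mass since `g(0) = 0`) and
   `μ = Φ₀ |y|₂^{-3-α} g(y) dy` with `Φ₀ = c'/J(e₀)`, `J(k) = ∫ (1 - cos(k·y))|y|₂^{-3-α} dy > 0`.
2. *Transforms.*  By Fubini and `cos a (1 - cos b) = ((1-cos(a+b)) + (1-cos(a-b)))/2 - (1-cos a)`,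
   `∫ cos(ξ·y) dμ_R = ∫ γ(η)((ψ_R(ξ+η) + ψ_R(ξ-η))/2 - ψ_R(ξ)) dη` (`levyCT_lattice_cos_transform`)
   and `∫ cos(ξ·y) dμ = ∫ γ(η)((Ψ(ξ+η) + Ψ(ξ-η))/2 - Ψ(ξ)) dη` with `Ψ(k) = Φ₀ J(k) = c'|k|₂^α`
   (`levyCT_density_cos_transform`; the last equality is rotation invariance and scaling of the
   stable Lévy measure, `levyCT_J_scaling`).  The sine transforms vanish by evenness.
3. *Convergence.*  Tightness gives `0 ≤ ψ_R(k) ≤ C₂(1 + |k|₂²)` for `R ≥ max(R₁,1)`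
   (`levyCT_symbol_le`); since `γ` has a finite second moment, dominated convergence and the
   hypothesis `ψ_R → Ψ` give `∫ cos(ξ·y) dμ_R → ∫ cos(ξ·y) dμ` for every `ξ` (`levyCT_dominated`).
4. *Lévy.*  By Lévy's continuity theorem for finite measures on `ℝ³` (`levyCT_levy_transfer`:
   push-forward to `EuclideanSpace ℝ (Fin 3)`, normalisation, Mathlib's
   `MeasureTheory.ProbabilityMeasure.tendsto_of_tendsto_charFun`), `∫ h dμ_R → ∫ h dμ` for every
   bounded continuous `h`; applied to `h = f/g` (`levyCT_test_function`) this is the claim, since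
   `∫ h dμ_R = R^α ∑ₓ m(x) f(x/R)` and `∫ h dμ = ∫ f(y) Φ₀|y|₂^{-3-α} dy`.

References: P. Lévy's continuity theorem (P. Billingsley, *Probability and Measure* (1995),
Thm. 26.3, §29); Lévy–Khintchine representation of the rotation invariant stable law (K. Sato,
*Lévy Processes and Infinitely Divisible Distributions* (1999), Thm. 8.1, Thm. 14.14); W. Feller,
*An Introduction to Probability Theory and its Applications* II (1971), XVII.  All auxiliary
statements are folklore; no definitions are introduced.
-/

noncomputable section

namespace Summit.CriticalPhenomena.Ising3DConformalLimit.Cruxes.DirectCorrelationStableTail.DiffusiveBranchIsNonsaturation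

open MeasureTheory Filter Topology
open scoped BigOperators
open Literature.Probability.LatticeModels

/-! ### The limit density `Φ₀ |y|₂^{-3-α} (1 - e^{-|y|₂²/2})` -/

/-- The weighted stable density `Φ₀ |y|₂^{-3-α} (1 - e^{-|y|₂²/2})` is integrable on `ℝ³` for
`0 < α < 2`. [folklore] -/
theorem levyCT_density_integrable {α : ℝ} (Φ₀ : ℝ) (hα0 : 0 < α) (hα2 : α < 2) :
    Integrable (fun y : Fin 3 → ℝ => Φ₀ * √(∑ i, y i ^ 2) ^ (-(3 + α)) *
      (1 - Real.exp (-(1 / 2 * ∑ i, y i ^ 2)))) := by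
  refine ((levyCT_integrable_majorant hα0 hα2).const_mul |Φ₀|).mono' ?_
    (ae_of_all _ fun y => ?_)
  · exact ((measurable_const.mul (kernSc_measurable_euclid_rpow _)).mul
      (by fun_prop : Continuous fun y : Fin 3 → ℝ =>
        1 - Real.exp (-(1 / 2 * ∑ i, y i ^ 2))).measurable).aestronglyMeasurable
  · have hK : 0 ≤ √(∑ i, y i ^ 2) ^ (-(3 + α)) := Real.rpow_nonneg (Real.sqrt_nonneg _) _
    rw [Real.norm_eq_abs, abs_mul, abs_mul, abs_of_nonneg hK, abs_of_nonneg (levyCT_weight_nonneg y)]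
    calc |Φ₀| * √(∑ i, y i ^ 2) ^ (-(3 + α)) * (1 - Real.exp (-(1 / 2 * ∑ i, y i ^ 2)))
        ≤ |Φ₀| * √(∑ i, y i ^ 2) ^ (-(3 + α)) * min 2 (∑ i, y i ^ 2) :=
          mul_le_mul_of_nonneg_left (levyCT_weight_le y) (by positivity)
      _ = |Φ₀| * (√(∑ i, y i ^ 2) ^ (-(3 + α)) * min 2 (∑ i, y i ^ 2)) := by ring

/-- The weighted stable density has positive total integral (`Φ₀ > 0`). [folklore] -/
theorem levyCT_density_integral_pos {α Φ₀ : ℝ} (hΦ₀ : 0 < Φ₀) (hα0 : 0 < α) (hα2 : α < 2) :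
    0 < ∫ y : Fin 3 → ℝ, Φ₀ * √(∑ i, y i ^ 2) ^ (-(3 + α)) *
      (1 - Real.exp (-(1 / 2 * ∑ i, y i ^ 2))) := by
  refine levyCT_integral_pos_of_pos_on_box _
    (fun y => mul_nonneg (mul_nonneg hΦ₀.le (Real.rpow_nonneg (Real.sqrt_nonneg _) _))
      (levyCT_weight_nonneg y)) (levyCT_density_integrable Φ₀ hα0 hα2) fun y hy => ?_
  have h0 : 0 < y 0 ^ 2 := by nlinarith [(hy 0).1]
  have hS : 0 < ∑ i, y i ^ 2 :=
    h0.trans_le (Finset.single_le_sum (fun i _ => sq_nonneg (y i)) (Finset.mem_univ 0))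
  have hg : 0 < 1 - Real.exp (-(1 / 2 * ∑ i, y i ^ 2)) := by
    rw [sub_pos, Real.exp_lt_one_iff]
    linarith
  exact mul_pos (mul_pos hΦ₀ (Real.rpow_pos_of_pos (Real.sqrt_pos.2 hS) _)) hg

/-- **Sine transform of the (even) stable density vanishes.** [folklore] -/
theorem levyCT_density_sin_transform (α Φ₀ : ℝ) (ξ : Fin 3 → ℝ) :
    ∫ y : Fin 3 → ℝ, Φ₀ * √(∑ i, y i ^ 2) ^ (-(3 + α)) *
        (1 - Real.exp (-(1 / 2 * ∑ i, y i ^ 2))) * Real.sin (∑ j, ξ j * y j) = 0 := by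
  set F : (Fin 3 → ℝ) → ℝ := fun y => Φ₀ * √(∑ i, y i ^ 2) ^ (-(3 + α)) *
    (1 - Real.exp (-(1 / 2 * ∑ i, y i ^ 2))) * Real.sin (∑ j, ξ j * y j) with hF
  have hneg : ∀ y, F (-y) = -F y := by
    intro y
    simp only [hF, Pi.neg_apply, mul_neg, neg_sq, Finset.sum_neg_distrib, Real.sin_neg]
  have h := integral_neg_eq_self F volume
  simp_rw [hneg, integral_neg] at h
  change ∫ y, F y = 0
  linarith

/-! ### The stub -/

/-- **Lévy continuity transfer (vague convergence of the rescaled lattice measures to the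
isotropic `α`-stable Lévy measure).**  See the module docstring for the statement and the proof.
[folklore] -/
theorem stub_levyContinuityTransfer :
    ∀ (m : Site 3 → ℝ) (α c' C C' : ℝ) (R₁ : ℕ),
      Summable m → (∀ y, y ≠ 0 → 0 ≤ m y) → (∀ y, m (-y) = m y) → 0 < α → α < 2 → 0 < c' →
      (∀ R : ℕ, R₁ ≤ R → ∀ T : Finset (Site 3), (∀ y ∈ T, (R : ℝ) ≤ ‖y‖) → (R : ℝ) ^ α * ∑ y ∈ T, m y ≤ C) →
      (∀ R : ℕ, 1 ≤ R → ∑ y ∈ box 3 R, m y * (∑ i, ((y i : ℝ)) ^ 2) ≤ C' * (R : ℝ) ^ (2 - α)) →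
      (∀ k : Fin 3 → ℝ,
        Filter.Tendsto (fun R : ℕ => (R : ℝ) ^ α * ∑' y : Site 3, m y * (1 - Real.cos (∑ i, k i * ((y i : ℝ) / R))))
          Filter.atTop (nhds (c' * Real.sqrt (∑ i, k i ^ 2) ^ α))) →
      ∃ Φ₀ : ℝ, 0 < Φ₀ ∧ ∀ f : (Fin 3 → ℝ) → ℝ, Continuous f → HasCompactSupport f → (0 : Fin 3 → ℝ) ∉ tsupport f →
        Filter.Tendsto (fun R : ℕ => (R : ℝ) ^ α * ∑' x : Site 3, m x * f (fun j => (x j : ℝ) / (R : ℝ)))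
          Filter.atTop (nhds (∫ y : Fin 3 → ℝ, f y * (Φ₀ * Real.sqrt (∑ l, y l ^ 2) ^ (-(3 + α))))) := by
  intro m α c' C C' R₁ hm hnn heven hα0 hα2 hc' htail hbox hψ
  -- the normalising constant `Φ₀ = c' / J(e₀)`
  have hJ₁pos := levyCT_J_pos hα0 hα2
  set J₁ : ℝ := ∫ y : Fin 3 → ℝ, (1 - Real.cos (y 0)) * √(∑ i, y i ^ 2) ^ (-(3 + α)) with hJ₁
  refine ⟨c' / J₁, div_pos hc' hJ₁pos, fun f hf hfc hf0 => ?_⟩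
  set Φ₀ : ℝ := c' / J₁ with hΦ₀
  have hΦ₀pos : 0 < Φ₀ := div_pos hc' hJ₁pos
  have hΦ₀J : Φ₀ * J₁ = c' := div_mul_cancel₀ c' hJ₁pos.ne'
  -- the symbols `ψ_R` and their limit `Ψ`
  obtain ⟨ψ, hψf⟩ : ∃ ψ : ℕ → (Fin 3 → ℝ) → ℝ, ∀ R : ℕ, ψ R = fun k =>
      (R : ℝ) ^ α * ∑' y : Site 3, m y * (1 - Real.cos (∑ i, k i * ((y i : ℝ) / R))) :=
    ⟨_, fun _ => rfl⟩
  obtain ⟨Ψ, hΨf⟩ : ∃ Ψ : (Fin 3 → ℝ) → ℝ, Ψ = fun k => c' * √(∑ i, k i ^ 2) ^ α := ⟨_, rfl⟩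
  have hψc : ∀ R, Continuous (ψ R) := fun R => by
    rw [hψf]
    exact levyCT_symbol_continuous m hm α R
  have hbound : ∀ᶠ R : ℕ in atTop, ∀ k, |ψ R k| ≤ (|C'| / 2 + 2 * |C|) * (1 + ∑ i, k i ^ 2) := by
    filter_upwards [eventually_ge_atTop (max R₁ 1)] with R hR k
    rw [hψf]
    beta_reduce
    rw [abs_of_nonneg (levyCT_symbol_nonneg m hnn α R k)]
    exact levyCT_symbol_le m α C C' R₁ hm hnn htail hbox R (le_of_max_le_left hR)
      (le_of_max_le_right hR) k
  have hlim : ∀ k, Tendsto (fun R => ψ R k) atTop (𝓝 (Ψ k)) := by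
    intro k
    simp only [hψf, hΨf]
    exact hψ k
  -- the Gaussian density `γ` and the weight `g`
  obtain ⟨γ, hγf⟩ : ∃ γ : (Fin 3 → ℝ) → ℝ,
      γ = fun η => Real.exp (-(1 / 2 * ∑ i, η i ^ 2)) / (2 * Real.pi) ^ (3 / 2 : ℝ) := ⟨_, rfl⟩
  obtain ⟨g, hgf⟩ : ∃ g : (Fin 3 → ℝ) → ℝ,
      g = fun y => 1 - Real.exp (-(1 / 2 * ∑ i, y i ^ 2)) := ⟨_, rfl⟩
  have hγc : Continuous γ := by
    rw [hγf]
    fun_prop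
  have hγ0 : ∀ η, 0 ≤ γ η := fun η => by
    rw [hγf]
    positivity
  have hγi : Integrable (fun η : Fin 3 → ℝ => (1 + ∑ i, η i ^ 2) * γ η) := by
    rw [hγf]
    exact levyCT_gauss_moment_integrable
  have hgγ : ∀ u, g u = ∫ η, γ η * (1 - Real.cos (∑ i, η i * u i)) := fun u => by
    rw [hgf, hγf]
    exact levyCT_weight_eq_gauss_average u
  have hg0 : ∀ y, 0 ≤ g y := fun y => by
    rw [hgf]
    exact levyCT_weight_nonneg y
  have hg2 : ∀ y, g y ≤ 2 := fun y => by
    rw [hgf]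
    exact (levyCT_weight_le y).trans (min_le_left _ _)
  -- the rescaled lattice measures `μ_R = ∑ₓ R^α m(x) g(x/R) δ_{x/R}`
  obtain ⟨p, hpf⟩ : ∃ p : ℕ → Site 3 → (Fin 3 → ℝ),
      p = fun (R : ℕ) (x : Site 3) (j : Fin 3) => (x j : ℝ) / (R : ℝ) := ⟨_, rfl⟩
  obtain ⟨w, hwf⟩ : ∃ w : ℕ → Site 3 → ℝ,
      w = fun (R : ℕ) (x : Site 3) => (R : ℝ) ^ α * m x * g (p R x) := ⟨_, rfl⟩
  have hw0 : ∀ R x, 0 ≤ w R x := by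
    intro R x
    rw [hwf]
    beta_reduce
    by_cases hx : x = 0
    · subst hx
      have h0 : g (p R 0) = 0 := by
        rw [hgf, hpf]
        simp
      rw [h0, mul_zero]
    · exact mul_nonneg (mul_nonneg (Real.rpow_nonneg (Nat.cast_nonneg R) α) (hnn x hx)) (hg0 _)
  have hws : ∀ R, Summable (w R) := by
    intro R
    refine Summable.of_nonneg_of_le (hw0 R) (fun x => ?_) (hm.abs.mul_left ((R : ℝ) ^ α * 2))
    rw [hwf]
    beta_reduce
    have hRα : 0 ≤ (R : ℝ) ^ α := Real.rpow_nonneg (Nat.cast_nonneg R) α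
    calc (R : ℝ) ^ α * m x * g (p R x) ≤ (R : ℝ) ^ α * |m x| * g (p R x) :=
          mul_le_mul_of_nonneg_right (mul_le_mul_of_nonneg_left (le_abs_self _) hRα) (hg0 _)
      _ ≤ (R : ℝ) ^ α * |m x| * 2 := mul_le_mul_of_nonneg_left (hg2 _) (by positivity)
      _ = (R : ℝ) ^ α * 2 * |m x| := by ring
  set μs : ℕ → Measure (Fin 3 → ℝ) := fun R =>
    Measure.sum fun x : Site 3 => ENNReal.ofReal (w R x) • Measure.dirac (p R x) with hμs
  haveI hfin : ∀ R, IsFiniteMeasure (μs R) := fun R =>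
    levyCT_isFiniteMeasure_sum_dirac (w R) (hw0 R) (hws R) (p R)
  have hμs_int : ∀ (R : ℕ) (φ : (Fin 3 → ℝ) → ℝ), Continuous φ → ∀ B : ℝ, (∀ y, |φ y| ≤ B) →
      ∫ y, φ y ∂(μs R) = ∑' x, w R x * φ (p R x) := fun R φ hφ B hB =>
    levyCT_integral_sum_dirac (w R) (hw0 R) (hws R) (p R) φ hφ B hB
  -- the limit measure `μ = Φ₀ |y|₂^{-3-α} g(y) dy`
  obtain ⟨d, hdf⟩ : ∃ d : (Fin 3 → ℝ) → ℝ,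
      d = fun y => Φ₀ * √(∑ i, y i ^ 2) ^ (-(3 + α)) * g y := ⟨_, rfl⟩
  have hd0 : ∀ y, 0 ≤ d y := fun y => by
    rw [hdf]
    exact mul_nonneg (mul_nonneg hΦ₀pos.le (Real.rpow_nonneg (Real.sqrt_nonneg _) _)) (hg0 y)
  have hdm : Measurable d := by
    rw [hdf, hgf]
    exact (measurable_const.mul (kernSc_measurable_euclid_rpow _)).mul
      (by fun_prop : Continuous fun y : Fin 3 → ℝ =>
        1 - Real.exp (-(1 / 2 * ∑ i, y i ^ 2))).measurable
  have hdi : Integrable d := by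
    rw [hdf, hgf]
    exact levyCT_density_integrable Φ₀ hα0 hα2
  have hdpos : 0 < ∫ y, d y := by
    rw [hdf, hgf]
    exact levyCT_density_integral_pos hΦ₀pos hα0 hα2
  set μ : Measure (Fin 3 → ℝ) := volume.withDensity fun y => ENNReal.ofReal (d y) with hμ
  haveI : IsFiniteMeasure μ := levyCT_isFiniteMeasure_withDensity d hdi
  have hμne : μ ≠ 0 := levyCT_withDensity_ne_zero d hd0 hdi hdpos
  have hμ_int : ∀ φ : (Fin 3 → ℝ) → ℝ, ∫ y, φ y ∂μ = ∫ y, d y * φ y := fun φ =>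
    levyCT_integral_withDensity d hd0 hdm φ
  -- rotation invariance and scaling: `Ψ(k) = Φ₀ J(k)`
  have hΨJ : ∀ k, Ψ k = Φ₀ * ∫ y : Fin 3 → ℝ,
      (1 - Real.cos (∑ i, k i * y i)) * √(∑ i, y i ^ 2) ^ (-(3 + α)) := by
    intro k
    rw [levyCT_J_scaling hα0 k, ← hJ₁, hΨf]
    beta_reduce
    rw [← hΦ₀J]
    ring
  -- convergence of the cosine transforms
  have hcos : ∀ ξ : Fin 3 → ℝ,
      Tendsto (fun R => ∫ y, Real.cos (∑ j, ξ j * y j) ∂(μs R)) atTop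
        (𝓝 (∫ y, Real.cos (∑ j, ξ j * y j) ∂μ)) := by
    intro ξ
    have hL : ∀ R : ℕ, ∫ y, Real.cos (∑ j, ξ j * y j) ∂(μs R) =
        ∫ η, γ η * ((ψ R (ξ + η) + ψ R (ξ - η)) / 2 - ψ R ξ) := by
      intro R
      rw [hμs_int R _ (by fun_prop) 1 (fun y => Real.abs_cos_le_one _), hwf, hpf, hgf, hγf]
      beta_reduce
      exact levyCT_lattice_cos_transform m hm α R (ψ R) (fun k => by rw [hψf]) ξ
    have hR : ∫ y, Real.cos (∑ j, ξ j * y j) ∂μ =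
        ∫ η, γ η * ((Ψ (ξ + η) + Ψ (ξ - η)) / 2 - Ψ ξ) := by
      rw [hμ_int, hdf]
      beta_reduce
      exact levyCT_density_cos_transform Φ₀ hα0 hα2 γ hγc hγ0 hγi g hgγ Ψ hΨJ ξ
    rw [hR]
    simp_rw [hL]
    rw [hγf]
    beta_reduce
    exact levyCT_dominated ψ Ψ hψc _ hbound hlim ξ
  -- the sine transforms all vanish (evenness)
  have hsin : ∀ ξ : Fin 3 → ℝ,
      Tendsto (fun R => ∫ y, Real.sin (∑ j, ξ j * y j) ∂(μs R)) atTop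
        (𝓝 (∫ y, Real.sin (∑ j, ξ j * y j) ∂μ)) := by
    intro ξ
    have hL : ∀ R : ℕ, ∫ y, Real.sin (∑ j, ξ j * y j) ∂(μs R) = 0 := by
      intro R
      rw [hμs_int R _ (by fun_prop) 1 (fun y => Real.abs_sin_le_one _), hwf, hpf, hgf]
      beta_reduce
      exact levyCT_lattice_sin_transform m heven α R ξ
    have hR : ∫ y, Real.sin (∑ j, ξ j * y j) ∂μ = 0 := by
      rw [hμ_int, hdf, hgf]
      beta_reduce
      exact levyCT_density_sin_transform α Φ₀ ξ
    rw [hR]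
    simp_rw [hL]
    exact tendsto_const_nhds
  -- Lévy: integrals of bounded continuous functions converge; apply to `h = f / g`
  obtain ⟨B, hhc, hhB, hgh⟩ := levyCT_test_function f hf hfc hf0
  have key := levyCT_levy_transfer μs μ hμne hcos hsin
    (fun y => f y / (1 - Real.exp (-(1 / 2 * ∑ i, y i ^ 2)))) hhc B hhB
  have hL2 : ∀ R : ℕ, ∫ y, f y / (1 - Real.exp (-(1 / 2 * ∑ i, y i ^ 2))) ∂(μs R) =
      (R : ℝ) ^ α * ∑' x : Site 3, m x * f (fun j => (x j : ℝ) / (R : ℝ)) := by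
    intro R
    rw [hμs_int R _ hhc B hhB, ← tsum_mul_left]
    refine tsum_congr fun x => ?_
    rw [hwf, hpf, hgf]
    beta_reduce
    rw [mul_assoc, hgh]
    ring
  have hR2 : ∫ y, f y / (1 - Real.exp (-(1 / 2 * ∑ i, y i ^ 2))) ∂μ =
      ∫ y, f y * (Φ₀ * √(∑ l, y l ^ 2) ^ (-(3 + α))) := by
    rw [hμ_int, hdf, hgf]
    refine integral_congr_ae (ae_of_all _ fun y => ?_)
    beta_reduce
    rw [mul_assoc, hgh]
    ring
  simp_rw [hL2] at key
  rw [hR2] at key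
  exact key

end Summit.CriticalPhenomena.Ising3DConformalLimit.Cruxes.DirectCorrelationStableTail.DiffusiveBranchIsNonsaturation

end
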